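import Literature.NumberTheory.EllipticCurves.Disegni2020.PAdicBSDRankOneNonsplit
import Literature.NumberTheory.EllipticCurves.PAdicBSDMultiplicativeRankOne
import Literature.NumberTheory.EllipticCurves.PAdicGrossZagierConstantTermProofs
import Literature.NumberTheory.EllipticCurves.AnalyticRankOrderProofs
import Literature.NumberTheory.EllipticCurves.CuspFormLFunctionAnalyticRankProofs
import Literature.NumberTheory.EllipticCurves.TamagawaFiniteIndexProofs
import HarnessLib

/-!
# DEDUP CLUSTER D1 (Disegni 2020, Thm. 4, first bullet): the valuation-form transcription A184
# `Disegni2020.padicBSD_rankOne_nonsplitMult` is DERIVED from the registry's fact of record A185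
# `Disegni2020.padicBSD_nonsplitMult_rankOne` — theorems only, no fact

Topic `Literature/NumberTheory/EllipticCurves` (cluster `Disegni2020`). HONEST FRAMING (BSD rank-`≤ 1`
residual cell `b2b-bsdres`, lane CLASS-CLOSURE, seat `cc-typer-6`; standing duty OWNERS.md §0 item 7,
referee R132.3 'Disegni 2020 quintuple', CITED-FACTS.md DEDUP CLUSTER D1): one printed theorem —
D. Disegni, Kyoto J. Math. 60 (2020) Thm. 4, first bullet (non-split multiplicative prime, analytic
rank one) — was vendored by several seats within minutes of each other. This file proves that the
valuation-form transcription `padicBSD_rankOne_nonsplitMult` (A184, p249273, this seat) FOLLOWS from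
the exact-identity transcription `padicBSD_nonsplitMult_rankOne` (A185, p249276, census-ctyper2,
the lane's fact of record) and tree theorems alone, so that the registry's INDEPENDENT count for the
first bullet is ONE: every consumer of A184 (`X2/ClassClosureO9.lean`, `X11b/RankOneNonsplitDisegni
.lean`, `X2/CongruenceTransferRankOne.lean`) is thereby fed by A185. Nothing new is asserted; no
definition; no named fact; the two `def`s are untouched (D-0026: a bridge, not a restatement).

## The derivation

A185 gives, at the data of A184, the exact identity
`ϖ · [T¹]L · log_p γ_cyc · #E(ℚ)_tors² = (1 - (-1)⁻¹) · (#Ш_an · Reg_p(E,Dh) · ∏ c_v)` with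
`1 - (-1)⁻¹ = 2` (`padicBSD_nonsplitMult_rankOne.identity_two`). A184's three clauses follow:
* `1 ≤ ord_T L` — no exceptional zero at a non-split prime but `L(E,1) = 0`: the interpolation
  `L(0) = 2·[0]⁺_f` (`IsMultPAdicLFunctionOf.constantCoeff_of_neg_one`, Greenberg LNM 1716 §4) and
  `[0]⁺_f = 0` from `L(E,1) = 0` (`ratPlusSymbol_zero_eq_zero_of_entireLFunction_eq_zero`, MTT §I.8
  (8.6)), `L(E,1) = 0` from `ord_{s=1} L(E,s) = 1` (`analyticRank_eq_zero_iff_holds`, with `L(E,s)`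
  entire by modularity-as-hypothesis `IsNewformOf.hasEntireLFunction`);
* granted `Reg_p(E,Dh) ≠ 0`: `#Ш_an ≠ 0` (`shaAn_def`: `L^{(r)}(E,1)/r! ≠ 0` by
  `leadingLCoeff_ne_zero_holds`, `Ω, ∏ c_v, Reg_NT, #T > 0`), so the right-hand side is non-zero,
  hence `[T¹]L ≠ 0` and `ord_T L = 1` exactly;
* and the valuation identity is the valuation of the exact one (`Padic.valuation_mul`,
  `Padic.valuation_ratCast`).

* `Disegni2020.padicBSD_rankOne_nonsplitMult_of_primary : padicBSD_nonsplitMult_rankOne →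
  padicBSD_rankOne_nonsplitMult` (A184 ⇐ A185), with the two lemmas of the first two bullets.

The converse is NOT claimed (A184 is valuation-only on the identity: strictly weaker than A185).

References: [Disegni2020] Thm. 4 (§3.2), Prop. 2 (§3.1); [Disegni2017] Thm. B;
[MazurTateTeitelbaum1986Invent] §I.8 (8.6), §I.14; [GreenbergLNM1716] §4; [SteinWuthrich2013] §4.2;
CITED-FACTS.md §A A183–A186, DEDUP CLUSTER D1; cc-typer-3's sibling bridge
`Disegni2020/PAdicBSDRankOneMultiplicativeProofs.lean` (p250798: A183's clauses ⇐ A185/A186).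
-/

set_option autoImplicit false

noncomputable section

open scoped Classical MatrixGroups ModularForm

open CongruenceSubgroup WeierstrassCurve Literature.NumberTheory.EllipticCurves.ModularForms
  Literature.NumberTheory.EllipticCurves.SteinWuthrich2013

namespace Literature.NumberTheory.EllipticCurves.Disegni2020

/-- **No exceptional zero, but `L(E,1) = 0`: `[T⁰]L = 0` for THE non-split Mazur–Tate–Teitelbaum
function of a curve of positive analytic rank.** `L(0) = (1 - α⁻¹)·[0]⁺_f = 2·[0]⁺_f` (`α = -1`)
and `[0]⁺_f = L(f,1)/Ω⁺_f = 0` since `L(E,1) = 0` (`ord_{s=1} L(E,s) ≠ 0`, `L(E,s)` entire for the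
modular `E`). [cite: MazurTateTeitelbaum1986Invent, §I.8 (8.6) and §I.14]
[cite: GreenbergLNM1716, §4 (PDF p. 113)] -/
theorem constantCoeff_eq_zero_of_isMultPAdicLFunctionOf_neg_one_of_analyticRank_ne_zero
    {W : WeierstrassCurve ℚ} [W.IsElliptic] {p : ℕ} [Fact p.Prime] {N : ℕ} [NeZero N]
    {f : CuspForm (Gamma0 N) 2} (hf : IsNewformOf W f) (hr : W.analyticRank ≠ 0)
    {L : PowerSeries ℚ_[p]} (hL : IsMultPAdicLFunctionOf f p (-1) L) :
    PowerSeries.constantCoeff L = 0 := by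
  have hE : W.HasEntireLFunction := hf.hasEntireLFunction
  have hL1 : W.entireLFunction 1 = 0 := by
    by_contra h
    exact hr ((W.analyticRank_eq_zero_iff_holds hE).mpr h)
  rw [hL.constantCoeff_of_neg_one, ratPlusSymbol_zero_eq_zero_of_entireLFunction_eq_zero hf hL1,
    Rat.cast_zero, mul_zero]

/-- **`#Ш_an ≠ 0`** for a modular elliptic `W/ℚ` (`IsNewformOf W f` supplies the entire
continuation): `#Ш_an = (L^{(r)}(E,1)/r!)·#T²/(Ω·∏ c_v·Reg_NT)` (`shaAn_def`, Miller 2011 Def. 1.1)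
with `L^{(r)}(E,1)/r! ≠ 0` by definition of `r = ord_{s=1}` (`leadingLCoeff_ne_zero_holds`) and
positive denominators. [cite: Miller2011LMS, Def. 1.1] [cite: BirchSwinnertonDyer1965] -/
theorem shaAn_ne_zero_of_isNewformOf {W : WeierstrassCurve ℚ} [W.IsElliptic] {N : ℕ} [NeZero N]
    {f : CuspForm (Gamma0 N) 2} (hf : IsNewformOf W f) : shaAn W ≠ 0 := by
  rw [shaAn_def]
  refine div_ne_zero (mul_ne_zero (W.leadingLCoeff_ne_zero_holds hf.hasEntireLFunction)
    (pow_ne_zero 2 (by exact_mod_cast W.torsionOrder_pos_holds.ne'))) ?_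
  exact mul_ne_zero (mul_ne_zero (by exact_mod_cast W.realPeriodRat_pos_holds.ne')
    (by exact_mod_cast (W.tamagawaProduct_pos').ne')) (by exact_mod_cast W.regulator_pos'.ne')

/-- **A184 ⇐ A185 (DEDUP CLUSTER D1).** The valuation-form transcription
`padicBSD_rankOne_nonsplitMult` of Disegni 2020 Thm. 4 (first bullet) follows from the
exact-identity transcription `padicBSD_nonsplitMult_rankOne` (the lane's fact of record) and tree
theorems: the order clause from the interpolation (`constantCoeff_eq_zero_of_isMultPAdicLFunctionOf_
neg_one_of_analyticRank_ne_zero`), exact order and the valuation identity from the exact identity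
with `#Ш_an ≠ 0` (`shaAn_ne_zero_of_isNewformOf`), `∏ c_v ≠ 0` and the hypothesis `Reg_p ≠ 0`. No
converse. [cite: Disegni2020, Thm. 4 first bullet (§3.2), Prop. 2 (§3.1)] [cite: Disegni2017, Thm. B]
[cite: SteinWuthrich2013, §4.2] -/
theorem padicBSD_rankOne_nonsplitMult_of_primary (h : padicBSD_nonsplitMult_rankOne) :
    padicBSD_rankOne_nonsplitMult := by
  intro W _ _ p _ hp2 hmult hns hr1 κ γ _ _ _ N _ f hf ϖ hϖ L hL q hq0 hq1 hqj Dh hDh s hs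
  have hc0 : PowerSeries.constantCoeff L = 0 :=
    constantCoeff_eq_zero_of_isMultPAdicLFunctionOf_neg_one_of_analyticRank_ne_zero hf
      (by rw [hr1]; exact one_ne_zero) hL
  have hord1 : 1 ≤ L.order := by
    refine PowerSeries.nat_le_order _ 1 fun i hi ↦ ?_
    interval_cases i
    simpa using hc0
  refine ⟨hord1, fun hReg ↦ ?_⟩
  -- the exact identity of A185 with the literal multiplier `2`
  have hid : (ϖ : ℚ_[p]) * PowerSeries.coeff 1 L * padicLog p (cyclotomicGenerator p) *
      (W.torsionOrder : ℚ_[p]) ^ 2 = 2 * ((s : ℚ_[p]) * padicRegulator Dh * W.tamagawaProduct) :=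
    padicBSD_nonsplitMult_rankOne.identity_two h W p hp2 hmult hns hr1 hq0 hq1 hqj hf hL hDh hϖ hs
  -- the right-hand side is non-zero
  have hs0 : s ≠ 0 := by
    intro h0
    apply shaAn_ne_zero_of_isNewformOf hf
    rw [hs, h0, Rat.cast_zero]
  have hsQ : ((s : ℚ) : ℚ_[p]) ≠ 0 := by exact_mod_cast hs0
  have hcp : (W.tamagawaProduct : ℚ_[p]) ≠ 0 := by
    exact_mod_cast (W.tamagawaProduct_pos').ne'
  have hM : (2 : ℚ_[p]) * (W.tamagawaProduct : ℚ_[p]) * padicRegulator Dh ≠ 0 :=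
    mul_ne_zero (mul_ne_zero two_ne_zero hcp) hReg
  have hR : (2 : ℚ_[p]) * ((s : ℚ_[p]) * padicRegulator Dh * W.tamagawaProduct) ≠ 0 := by
    have : (2 : ℚ_[p]) * ((s : ℚ_[p]) * padicRegulator Dh * W.tamagawaProduct) =
        2 * (W.tamagawaProduct : ℚ_[p]) * padicRegulator Dh * (s : ℚ_[p]) := by ring
    rw [this]
    exact mul_ne_zero hM hsQ
  -- hence `[T¹]L ≠ 0` and `ord_T L = 1`
  have hc1 : PowerSeries.coeff 1 L ≠ 0 := by
    intro h1
    apply hR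
    rw [← hid, h1, mul_zero, zero_mul, zero_mul]
  have hord : L.order = ((1 : ℕ) : ℕ∞) := by
    rw [PowerSeries.order_eq_nat]
    refine ⟨hc1, fun i hi ↦ ?_⟩
    interval_cases i
    simpa using hc0
  refine ⟨hord, ?_⟩
  -- the valuation identity is the valuation of the exact one
  have hid' : ((ϖ : ℚ) : ℚ_[p]) * PowerSeries.coeff 1 L *
      (padicLog p (cyclotomicGenerator p) ^ 1 * (W.torsionOrder : ℚ_[p]) ^ 2) =
      2 * (W.tamagawaProduct : ℚ_[p]) * padicRegulator Dh * (s : ℚ_[p]) := by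
    rw [pow_one, ← mul_assoc, hid]; ring
  rw [hid', Padic.valuation_mul hM hsQ, Padic.valuation_ratCast]

end Literature.NumberTheory.EllipticCurves.Disegni2020

end
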